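import Mathlib
import Summits.RiemannHypothesis.RiemannHypothesis.Theorems.IntegerScrewExitDensity
import Summits.RiemannHypothesis.RiemannHypothesis.Theorems.IntegerScrewExitGreenSharpLower
import Literature.NumberTheory.LFunctions.MertensFirstVonMangoldtLower
import HarnessLib

/-!
# Route `IntegerScrew` — THEOREM A, preparations: numerical facts, the χ² from a two-sided range, and the
# sharp Green data at `κ = 4`, `κ′ = 5`, `c′ = 1` (CONTINUUM-LIMIT §26.2)

* `natLog_two_le_log_div` (`⌊log₂R⌋ ≤ log R/log 2`), `sum_Icc_inv_le_one_add_log` (`H_Q ≤ 1 + log Q`, Mathlib's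
  harmonic bound), `exp_five_lt` (`e⁵ < 148.42`), `five_le_log_succ` (`148 ≤ Q ⇒ 5 ≤ log(Q+1)`);
* `exitChiSq_le_of_range` — values `b·ν_exit(b) ∈ [m_lo, m_hi]` on `[1, Q]` ⇒ `exitChiSq R Q ≤ H_Q·(m_hi − m_lo)²`
  (the centre `exitMassRatio R Q` is the `1/b`-weighted mean of the values, `sum_exitInflow_eq`);
* `mertens_lower_one` (`c′ = 1` from `Literature…MertensFirstLower.log_sub_one_le_sum_vonMangoldt_div'`),
  `exitGamma_le_four` (`Γ ≤ (1 + 4/log(Q+1))·log R/log x` for `Q ≥ 148`), `five_le_exitGamma`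
  (`(1 − 5/log(Q+1))·log R/log x ≤ Γ` for `Q ≥ 148`).

Consumed by `IntegerScrewTheoremA` (the packaged window law) and `IntegerScrewFlatRange`.
RH-free, elementary.  Nothing in this file bears on the truth of RH.
References: CONTINUUM-LIMIT §25–26 (rh-explicit A6-PIVOT); M. Suzuki, J. Lond. Math. Soc. (2) 108 (2023)
1448–1487 [Suzuki2023] for the screw matrices this serves.
-/

noncomputable section

set_option linter.dupNamespace false -- D-0017: `Summit.<S>.<S>.…` is the designed namespace

namespace Summit.RiemannHypothesis.RiemannHypothesis.Theorems.IntegerScrew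

open Finset Real
open ArithmeticFunction (vonMangoldt)

/-! ### Three numerical facts -/

/-- `⌊log₂ R⌋ ≤ log R/log 2` for `R ≥ 1`. -/
theorem natLog_two_le_log_div {R : ℕ} (hR : 1 ≤ R) : (Nat.log 2 R : ℝ) ≤ Real.log R / Real.log 2 := by
  have hlog2 : 0 < Real.log 2 := Real.log_pos (by norm_num)
  rw [le_div_iff₀ hlog2, ← Real.log_pow]
  refine Real.log_le_log (by positivity) ?_
  exact_mod_cast Nat.pow_log_le_self 2 (by omega : R ≠ 0)

/-- `H_Q = Σ_{b ≤ Q} 1/b ≤ 1 + log Q` (Mathlib's `harmonic_le_one_add_log`). -/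
theorem sum_Icc_inv_le_one_add_log (Q : ℕ) : ∑ b ∈ Icc 1 Q, (1 : ℝ) / b ≤ 1 + Real.log Q := by
  have h := harmonic_le_one_add_log Q
  rw [harmonic_eq_sum_Icc, Rat.cast_sum] at h
  simpa [one_div] using h

/-- `e⁵ < 148.42`. -/
theorem exp_five_lt : Real.exp 5 < 148.42 := by
  have h := Real.exp_one_lt_d9
  have h5 : Real.exp 5 = Real.exp 1 ^ 5 := by rw [← Real.exp_nat_mul]; norm_num
  rw [h5]
  have h0 : 0 < Real.exp 1 := Real.exp_pos 1
  calc Real.exp 1 ^ 5 < 2.7182818286 ^ 5 := by gcongr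
    _ < 148.42 := by norm_num

/-- `148 ≤ Q ⇒ 5 ≤ log(Q+1)` (`e⁵ < 148.42 ≤ 149`). -/
theorem five_le_log_succ {Q : ℕ} (hQ : 148 ≤ Q) : 5 ≤ Real.log ((Q : ℝ) + 1) := by
  rw [Real.le_log_iff_exp_le (by positivity)]
  have : (149 : ℝ) ≤ (Q : ℝ) + 1 := by exact_mod_cast (show 149 ≤ Q + 1 by omega)
  linarith [exp_five_lt]

/-! ### The χ² from a two-sided range -/

/-- If `m_lo ≤ b·ν_exit(b) ≤ m_hi` for every `1 ≤ b ≤ Q` (`1 ≤ Q ≤ R`) then `exitChiSq R Q ≤ H_Q·(m_hi − m_lo)²`: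
the centre `c = exitMassRatio R Q` is the `1/b`-weighted MEAN of the values `b·ν_exit(b)` (`sum_exitInflow_eq`), so
it lies in `[m_lo, m_hi]` too. -/
theorem exitChiSq_le_of_range {R Q : ℕ} (hQ : 1 ≤ Q) (hQR : Q ≤ R) {mlo mhi : ℝ}
    (h : ∀ b, 1 ≤ b → b ≤ Q → mlo ≤ (b : ℝ) * exitInflow R Q b ∧ (b : ℝ) * exitInflow R Q b ≤ mhi) :
    exitChiSq R Q ≤ (∑ b ∈ Icc 1 Q, (1 : ℝ) / b) * (mhi - mlo) ^ 2 := by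
  have hH : 0 < ∑ b ∈ Icc 1 Q, (1 : ℝ) / b :=
    Finset.sum_pos (fun b hb => by have := (Finset.mem_Icc.1 hb).1; positivity) ⟨1, by simp [hQ]⟩
  set c := exitMassRatio R Q with hc
  -- c is the weighted mean: c·H_Q = Σ_b ν(b) = Σ_b (1/b)·(b ν(b))
  have hcH : c * ∑ b ∈ Icc 1 Q, (1 : ℝ) / b = ∑ b ∈ Icc 1 Q, exitInflow R Q b := by
    rw [hc, exitMassRatio, div_mul_cancel₀ _ hH.ne', sum_exitInflow_eq hQ hQR]
  -- mlo ≤ c ≤ mhi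
  have hlo : mlo ≤ c := by
    have h1 : mlo * ∑ b ∈ Icc 1 Q, (1 : ℝ) / b ≤ c * ∑ b ∈ Icc 1 Q, (1 : ℝ) / b := by
      rw [hcH, Finset.mul_sum]
      refine Finset.sum_le_sum fun b hb => ?_
      have hb1 := (Finset.mem_Icc.1 hb).1
      have hb0 : (0 : ℝ) < b := by exact_mod_cast (show 0 < b by omega)
      have := (h b hb1 (Finset.mem_Icc.1 hb).2).1
      calc mlo * (1 / (b : ℝ)) = mlo / b := by ring
        _ ≤ (b : ℝ) * exitInflow R Q b / b := div_le_div_of_nonneg_right this hb0.le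
        _ = exitInflow R Q b := by field_simp
    exact le_of_mul_le_mul_right h1 hH
  have hhi : c ≤ mhi := by
    have h1 : c * ∑ b ∈ Icc 1 Q, (1 : ℝ) / b ≤ mhi * ∑ b ∈ Icc 1 Q, (1 : ℝ) / b := by
      rw [hcH, Finset.mul_sum]
      refine Finset.sum_le_sum fun b hb => ?_
      have hb1 := (Finset.mem_Icc.1 hb).1
      have hb0 : (0 : ℝ) < b := by exact_mod_cast (show 0 < b by omega)
      have := (h b hb1 (Finset.mem_Icc.1 hb).2).2
      calc exitInflow R Q b = (b : ℝ) * exitInflow R Q b / b := by field_simp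
        _ ≤ mhi / b := div_le_div_of_nonneg_right this hb0.le
        _ = mhi * (1 / (b : ℝ)) := by ring
    exact le_of_mul_le_mul_right h1 hH
  unfold exitChiSq
  rw [Finset.sum_mul]
  refine Finset.sum_le_sum fun b hb => ?_
  have hb1 := (Finset.mem_Icc.1 hb).1
  have hb0 : (0 : ℝ) < b := by exact_mod_cast (show 0 < b by omega)
  have hx := h b hb1 (Finset.mem_Icc.1 hb).2
  have habs : ((b : ℝ) * exitInflow R Q b - c) ^ 2 ≤ (mhi - mlo) ^ 2 := sq_le_sq' (by linarith) (by linarith)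
  have hre : (b : ℝ) * (exitInflow R Q b - c / b) ^ 2 = (1 / (b : ℝ)) * ((b : ℝ) * exitInflow R Q b - c) ^ 2 := by
    field_simp
  rw [hre]
  exact mul_le_mul_of_nonneg_left habs (by positivity)

/-! ### The sharp Green data at `κ = 4`, `κ′ = 5`, `c′ = 1` -/

/-- The lower Mertens constant `c′ = 1` (Hardy–Wright Thm 424, tree file `MertensFirstVonMangoldtLower`). -/
theorem mertens_lower_one (R : ℕ) :
    ∀ n, 1 ≤ n → n ≤ R → Real.log n - 1 ≤ ∑ k ∈ Icc 1 n, vonMangoldt k / k :=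
  fun _ hn _ => Literature.NumberTheory.LFunctions.MertensFirstLower.log_sub_one_le_sum_vonMangoldt_div' hn

/-- `Γ(x) ≤ (1 + 4/log(Q+1))·log R/log x` on the window, for `Q ≥ 148` (`exitGamma_le_sharp'` at `κ = 4`). -/
theorem exitGamma_le_four {R Q : ℕ} (hQ : 148 ≤ Q) :
    ∀ x, Q < x → x ≤ R →
      exitGamma R Q x ≤ (1 + 4 / Real.log ((Q : ℝ) + 1)) * Real.log R / Real.log x := by
  have ha := five_le_log_succ hQ
  refine exitGamma_le_sharp' (by omega) (by norm_num) ?_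
  have : 4 / Real.log ((Q : ℝ) + 1) ≤ 4 / 5 := div_le_div_of_nonneg_left (by norm_num) (by norm_num) ha
  nlinarith

/-- `(1 − 5/log(Q+1))·log R/log x ≤ Γ(x)` on the window, for `Q ≥ 148` (`le_exitGamma_sharp'` at `κ′ = 5`,
`c′ = 1`). -/
theorem five_le_exitGamma {R Q : ℕ} (hQ : 148 ≤ Q) :
    ∀ x, Q < x → x ≤ R →
      (1 - 5 / Real.log ((Q : ℝ) + 1)) * Real.log R / Real.log x ≤ exitGamma R Q x := by
  have ha := five_le_log_succ hQ
  refine le_exitGamma_sharp' (by omega) (by norm_num) (mertens_lower_one R) ?_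
  have h1 : 39 / 25 * (5 : ℝ) / Real.log ((Q : ℝ) + 1) ≤ 39 / 25 * 5 / 5 :=
    div_le_div_of_nonneg_left (by norm_num) (by norm_num) ha
  have h2 := Real.log_two_lt_d9
  linarith

end Summit.RiemannHypothesis.RiemannHypothesis.Theorems.IntegerScrew

end
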